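import Summits.Ventures.LatticeQCDFlow.Exactness.ReversibleVariationalSupTauInt
import HarnessLib

/-!
# The comparison theorem is SHARP: for the lazy version `(1 − p)K + p·1` of any reversible exact sampler the Abel autocorrelation sums transform EXACTLY, `A^{(p)}_s = A_r/(1 − s p)`, and `τ_int^{(p)} + ½ = (τ_int + ½)/(1 − p)`

HONEST FRAMING: exact (Metropolis-corrected) sampling algorithms for lattice gauge theory;
figures of merit are autocorrelation/cost numbers at stated couplings and volumes; no
continuum-physics claim.  (SCALAR calibration rung S0-A: not a gauge result.)

Venture `LatticeQCDFlow` (cell pub-lqcd), topic `Exactness`; FANOUT row 2 (`s0-phi4`).  NEW WORK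
of the cell over `Exactness/ReversibleVariationalSup.lean` / `ReversibleVariationalSupTauInt.lean`
(least-constant characterisation of the Abel sum / of `Σ_k C(k)`) in the `RevOp` format.  Nothing is
cited as a fact; elementary.  Printed counterpart NAMED ONLY: the remark that the comparison theorem
with a constant `c` is Peskun's theorem against the lazy chain `cK + (1 − c)·1` (Tierney 1998;
recorded in the tree's `Exactness/IMHTauIntModelComparison.lean` docstring), and the spectral
identity `Σ_k ((1 − p)λ + p)ᵏ = (1 − p)⁻¹ (1 − λ)⁻¹` behind "holding with probability `p` multiplies
`τ_int + ½` by `1/(1 − p)`" (folklore).  Here WITHOUT spectral theory, for every observable of an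
admissible class, as the two-sided instance of `Exactness/ReversibleComparison.lean` in which both
Dirichlet dominations hold with reciprocal constants (`𝓔^{(p)} = (1 − p) 𝓔`): the comparison
theorem loses nothing.

## Setting

`RevOp` format (`w ≥ 0`, class `A` with (int) (comb), `K` with (stab) (lin) (symm) (contr)); the
LAZY operator `K^{(p)} f = (1 − p) K f + p f` (`0 ≤ p ≤ 1`: hold with probability `p`, else move by
`K`), given as ANY operator `L` with `L f x = (1 − p) K f x + p f x` pointwise (hypothesis `hL`; no
definition added);
`C(k) = ∫ g (Kᵏ g) w`, `C^{(p)}(k)` likewise; `Q_r(v) = ∫ v² w − r ∫ v (K v) w`.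

## What is proved (namespace `RevOp`)

* `smul_mem`, `lazy_mem`, `lazy_add_mul`, `lazy_symm`, `lazy_contr` — `K^{(p)}` is again a
  reversible exact sampler on `A` in the `RevOp` sense (contraction by convexity of the square);
* `quadForm_lazy_eq` — `Q^{(p)}_s(v) = (1 − s p) · Q_r(v)` with `r = s(1 − p)/(1 − s p)`; at `s = 1`:
  `dirichlet_lazy_eq` — `𝓔^{(p)}(v) = (1 − p) 𝓔(v)`;
* **`abelSum_lazy_eq`** — for `0 ≤ p < 1`, `0 ≤ s < 1` and every `g ∈ A`:
  **`Σ_k C^{(p)}(k) sᵏ = (Σ_k C(k) rᵏ)/(1 − s p)`**, `r = s(1 − p)/(1 − s p)` (both least-constant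
  theorems; unconditional);
* **`tsum_lazy_eq`**, **`tauInt_lazy_eq`** — under summability of both series (`P > 0`):
  `Σ_k C^{(p)}(k) = (Σ_k C(k))/(1 − p)` and **`τ_int^{(p)}(g) + ½ = (τ_int(g) + ½)/(1 − p)`**.

Reading (no numerics implied): a sampler that skips its update with probability `p` (to save the
cost of a fraction `p` of the updates, say) pays EXACTLY the factor `1/(1 − p)` in `τ_int + ½` on
every observable — cost per effective sample is invariant only in the combination
`(τ_int + ½) × (work per step)`, not in `τ_int × work`.  NOT CLAIMED: anything for a particular
lattice sampler beyond instantiation; non-reversible updates.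
-/

namespace Summit.Ventures.LatticeQCDFlow.Exactness

open Real MeasureTheory Filter Finset Topology
open Summit.Ventures.LatticeQCDFlow.Scoring

namespace RevOp

variable {X : Type*} [MeasurableSpace X] {μ : Measure X} {w : X → ℝ} {A : (X → ℝ) → Prop}
  {K L : (X → ℝ) → (X → ℝ)} {p : ℝ}

/-! ## §1 The lazy operator is again in the format -/

omit [MeasurableSpace X] in
/-- Scalar multiples stay in the class: `A h → A (c h)` (from (comb): `h + (c − 1) h`). -/
theorem smul_mem (hAc : ∀ ⦃f h : X → ℝ⦄ (c : ℝ), A f → A h → A (fun x => f x + c * h x))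
    {h : X → ℝ} (hh : A h) (c : ℝ) : A (fun x => c * h x) := by
  have h1 := hAc (c - 1) hh hh
  have e : (fun x => h x + (c - 1) * h x) = fun x => c * h x := funext fun x => by ring
  rw [e] at h1
  exact h1

omit [MeasurableSpace X] in
/-- **(stab)** for the lazy operator: `A f → A ((1 − p) K f + p f)`. -/
theorem lazy_mem (hAc : ∀ ⦃f h : X → ℝ⦄ (c : ℝ), A f → A h → A (fun x => f x + c * h x))
    (hAK : ∀ ⦃f : X → ℝ⦄, A f → A (K f)) (hL : ∀ f x, L f x = (1 - p) * K f x + p * f x)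
    {f : X → ℝ} (hf : A f) : A (L f) := by
  have e : L f = fun x => (1 - p) * K f x + p * f x := funext (hL f)
  rw [e]
  exact hAc p (smul_mem hAc (hAK hf) (1 - p)) hf

omit [MeasurableSpace X] in
/-- **(lin)** for the lazy operator. -/
theorem lazy_add_mul
    (hlin : ∀ ⦃f h : X → ℝ⦄ (c : ℝ), A f → A h →
      ∀ x, K (fun s => f s + c * h s) x = K f x + c * K h x)
    (hL : ∀ f x, L f x = (1 - p) * K f x + p * f x)
    {f h : X → ℝ} (c : ℝ) (hf : A f) (hh : A h) (x : X) :
    L (fun s => f s + c * h s) x = L f x + c * L h x := by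
  rw [hL, hL, hL, hlin c hf hh x]
  ring

/-- **(symm)** for the lazy operator: `∫ (K^{(p)} f) h w = ∫ f (K^{(p)} h) w`. -/
theorem lazy_symm (hAi : ∀ ⦃f h : X → ℝ⦄, A f → A h → Integrable (fun x => f x * h x * w x) μ)
    (hAK : ∀ ⦃f : X → ℝ⦄, A f → A (K f))
    (hsymm : ∀ ⦃f h : X → ℝ⦄, A f → A h →
      ∫ x, K f x * h x * w x ∂μ = ∫ x, f x * K h x * w x ∂μ)
    (hL : ∀ f x, L f x = (1 - p) * K f x + p * f x) {f h : X → ℝ} (hf : A f) (hh : A h) :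
    ∫ x, L f x * h x * w x ∂μ = ∫ x, f x * L h x * w x ∂μ := by
  simp only [hL]
  have i1 : Integrable (fun x => (1 - p) * (K f x * h x * w x)) μ := (hAi (hAK hf) hh).const_mul _
  have i2 : Integrable (fun x => p * (f x * h x * w x)) μ := (hAi hf hh).const_mul _
  have i3 : Integrable (fun x => (1 - p) * (f x * K h x * w x)) μ := (hAi hf (hAK hh)).const_mul _
  have e1 : ∀ x, ((1 - p) * K f x + p * f x) * h x * w x
      = (1 - p) * (K f x * h x * w x) + p * (f x * h x * w x) := fun x => by ring
  have e2 : ∀ x, f x * ((1 - p) * K h x + p * h x) * w x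
      = (1 - p) * (f x * K h x * w x) + p * (f x * h x * w x) := fun x => by ring
  simp_rw [e1, e2]
  rw [integral_add i1 i2, integral_add i3 i2, integral_const_mul, integral_const_mul,
    integral_const_mul, hsymm hf hh]

/-- **(contr)** for the lazy operator (`0 ≤ p ≤ 1`): `∫ (K^{(p)} f)² w ≤ ∫ f² w` — convexity of the
square, `((1 − p)a + p b)² ≤ (1 − p)a² + p b²`, and the contraction property of `K`. -/
theorem lazy_contr (hw0 : ∀ x, 0 ≤ w x)
    (hAi : ∀ ⦃f h : X → ℝ⦄, A f → A h → Integrable (fun x => f x * h x * w x) μ)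
    (hAc : ∀ ⦃f h : X → ℝ⦄ (c : ℝ), A f → A h → A (fun x => f x + c * h x))
    (hAK : ∀ ⦃f : X → ℝ⦄, A f → A (K f))
    (hcontr : ∀ ⦃f : X → ℝ⦄, A f → ∫ x, K f x ^ 2 * w x ∂μ ≤ ∫ x, f x ^ 2 * w x ∂μ)
    (hL : ∀ f x, L f x = (1 - p) * K f x + p * f x)
    (hp0 : 0 ≤ p) (hp1 : p ≤ 1) {f : X → ℝ} (hf : A f) :
    ∫ x, L f x ^ 2 * w x ∂μ ≤ ∫ x, f x ^ 2 * w x ∂μ := by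
  have hLf := lazy_mem hAc hAK hL hf
  have iL : Integrable (fun x => ((1 - p) * K f x + p * f x) ^ 2 * w x) μ :=
    (integrable_sq_mul hAi hLf).congr (Eventually.of_forall fun x => by simp only [hL])
  simp only [hL]
  have iK : Integrable (fun x => K f x ^ 2 * w x) μ := integrable_sq_mul hAi (hAK hf)
  have iF : Integrable (fun x => f x ^ 2 * w x) μ := integrable_sq_mul hAi hf
  have hmono : ∫ x, ((1 - p) * K f x + p * f x) ^ 2 * w x ∂μ
      ≤ ∫ x, ((1 - p) * (K f x ^ 2 * w x) + p * (f x ^ 2 * w x)) ∂μ := by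
    refine integral_mono iL ((iK.const_mul _).add (iF.const_mul _)) fun x => ?_
    show ((1 - p) * K f x + p * f x) ^ 2 * w x ≤ (1 - p) * (K f x ^ 2 * w x) + p * (f x ^ 2 * w x)
    have hcvx : ((1 - p) * K f x + p * f x) ^ 2 ≤ (1 - p) * K f x ^ 2 + p * f x ^ 2 := by
      nlinarith [mul_nonneg (mul_nonneg hp0 (sub_nonneg.2 hp1)) (sq_nonneg (K f x - f x))]
    calc ((1 - p) * K f x + p * f x) ^ 2 * w x ≤ ((1 - p) * K f x ^ 2 + p * f x ^ 2) * w x :=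
          mul_le_mul_of_nonneg_right hcvx (hw0 x)
      _ = (1 - p) * (K f x ^ 2 * w x) + p * (f x ^ 2 * w x) := by ring
  rw [integral_add (iK.const_mul _) (iF.const_mul _), integral_const_mul, integral_const_mul] at hmono
  have hK := hcontr hf
  nlinarith [mul_le_mul_of_nonneg_left hK (sub_nonneg.2 hp1)]

/-! ## §2 The regularised Dirichlet forms transform exactly -/

/-- **`Q^{(p)}_s(v) = (1 − s p) · Q_r(v)`**, `r = s(1 − p)/(1 − s p)` (`s p ≠ 1`). -/
theorem quadForm_lazy_eq (hAi : ∀ ⦃f h : X → ℝ⦄, A f → A h → Integrable (fun x => f x * h x * w x) μ)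
    (hAK : ∀ ⦃f : X → ℝ⦄, A f → A (K f)) (hL : ∀ f x, L f x = (1 - p) * K f x + p * f x)
    {s : ℝ} (hsp : s * p ≠ 1) {v : X → ℝ} (hv : A v) :
    (∫ x, v x ^ 2 * w x ∂μ) - s * ∫ x, v x * L v x * w x ∂μ
      = (1 - s * p) * ((∫ x, v x ^ 2 * w x ∂μ)
          - (s * (1 - p) / (1 - s * p)) * ∫ x, v x * K v x * w x ∂μ) := by
  simp only [hL]
  have i1 : Integrable (fun x => (1 - p) * (v x * K v x * w x)) μ := (hAi hv (hAK hv)).const_mul _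
  have i2 : Integrable (fun x => p * (v x ^ 2 * w x)) μ := (integrable_sq_mul hAi hv).const_mul _
  have e : ∀ x, v x * ((1 - p) * K v x + p * v x) * w x
      = (1 - p) * (v x * K v x * w x) + p * (v x ^ 2 * w x) := fun x => by ring
  simp_rw [e]
  rw [integral_add i1 i2, integral_const_mul, integral_const_mul]
  have h1 : (1 : ℝ) - s * p ≠ 0 := sub_ne_zero.2 (Ne.symm hsp)
  field_simp
  ring

/-- **`𝓔^{(p)}(v) = (1 − p) · 𝓔(v)`** (`p ≠ 1`; the case `s = 1`). -/
theorem dirichlet_lazy_eq (hAi : ∀ ⦃f h : X → ℝ⦄, A f → A h → Integrable (fun x => f x * h x * w x) μ)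
    (hAK : ∀ ⦃f : X → ℝ⦄, A f → A (K f)) (hL : ∀ f x, L f x = (1 - p) * K f x + p * f x)
    (hp : p ≠ 1) {v : X → ℝ} (hv : A v) :
    (∫ x, v x ^ 2 * w x ∂μ) - ∫ x, v x * L v x * w x ∂μ
      = (1 - p) * ((∫ x, v x ^ 2 * w x ∂μ) - ∫ x, v x * K v x * w x ∂μ) := by
  have h := quadForm_lazy_eq hAi hAK hL (s := 1) (by rwa [one_mul]) hv
  rw [one_mul] at h
  rw [h]
  have h1 : (1 : ℝ) - p ≠ 0 := sub_ne_zero.2 (Ne.symm hp)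
  rw [one_mul, one_mul, div_self h1, one_mul]

/-! ## §3 The Abel sums transform exactly -/

/-- **THE LAZY-CHAIN IDENTITY, ABEL FORM (unconditional).**  For `0 ≤ p < 1`, `0 ≤ s < 1` and every
`g ∈ A`:  `Σ_k C^{(p)}(k) sᵏ = (Σ_k C(k) rᵏ) / (1 − s p)` with `r = s(1 − p)/(1 − s p)`
(`C(k) = ∫ g (Kᵏ g) w`, `C^{(p)}(k)` the same for `K^{(p)} = (1 − p)K + p·1`). -/
theorem abelSum_lazy_eq (hw0 : ∀ x, 0 ≤ w x)
    (hAi : ∀ ⦃f h : X → ℝ⦄, A f → A h → Integrable (fun x => f x * h x * w x) μ)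
    (hAc : ∀ ⦃f h : X → ℝ⦄ (c : ℝ), A f → A h → A (fun x => f x + c * h x))
    (hAK : ∀ ⦃f : X → ℝ⦄, A f → A (K f))
    (hlin : ∀ ⦃f h : X → ℝ⦄ (c : ℝ), A f → A h →
      ∀ x, K (fun s => f s + c * h s) x = K f x + c * K h x)
    (hsymm : ∀ ⦃f h : X → ℝ⦄, A f → A h →
      ∫ x, K f x * h x * w x ∂μ = ∫ x, f x * K h x * w x ∂μ)
    (hcontr : ∀ ⦃f : X → ℝ⦄, A f → ∫ x, K f x ^ 2 * w x ∂μ ≤ ∫ x, f x ^ 2 * w x ∂μ)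
    (hL : ∀ f x, L f x = (1 - p) * K f x + p * f x)
    (hp0 : 0 ≤ p) (hp1 : p < 1) {g : X → ℝ} (hg : A g) {s : ℝ} (hs0 : 0 ≤ s) (hs1 : s < 1) :
    ∑' k, (∫ x, g x * (L^[k] g) x * w x ∂μ) * s ^ k
      = (∑' k, (∫ x, g x * (K^[k] g) x * w x ∂μ) * (s * (1 - p) / (1 - s * p)) ^ k)
        / (1 - s * p) := by
  -- the lazy operator in the format
  have hAL : ∀ ⦃f : X → ℝ⦄, A f → A (L f) := fun f hf => lazy_mem hAc hAK hL hf
  have hlinL : ∀ ⦃f h : X → ℝ⦄ (c : ℝ), A f → A h → ∀ x,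
      L (fun s => f s + c * h s) x = L f x + c * L h x :=
    fun f h c hf hh x => lazy_add_mul hlin hL c hf hh x
  have hsymmL : ∀ ⦃f h : X → ℝ⦄, A f → A h →
      ∫ x, L f x * h x * w x ∂μ = ∫ x, f x * L h x * w x ∂μ :=
    fun f h hf hh => lazy_symm hAi hAK hsymm hL hf hh
  have hcontrL : ∀ ⦃f : X → ℝ⦄, A f → ∫ x, L f x ^ 2 * w x ∂μ ≤ ∫ x, f x ^ 2 * w x ∂μ :=
    fun f hf => lazy_contr hw0 hAi hAc hAK hcontr hL hp0 hp1.le hf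
  -- parameters
  have hsp1 : 0 < 1 - s * p := by nlinarith [mul_le_mul hs1.le hp1.le hp0 zero_le_one]
  have hsp : s * p ≠ 1 := fun h => by linarith
  set r := s * (1 - p) / (1 - s * p) with hr
  have hr0 : 0 ≤ r := div_nonneg (mul_nonneg hs0 (by linarith)) hsp1.le
  have hr1 : r < 1 := by rw [hr, div_lt_one hsp1]; nlinarith
  set AK := ∑' k, (∫ x, g x * (K^[k] g) x * w x ∂μ) * r ^ k with hAK_def
  set AL := ∑' k, (∫ x, g x * (L^[k] g) x * w x ∂μ) * s ^ k with hAL_def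
  have hAK0 : 0 ≤ AK := abelSum_nonneg hw0 hAi hAK hsymm hcontr hg hr0 hr1
  have hAL0 : 0 ≤ AL := abelSum_nonneg hw0 hAi hAL hsymmL hcontrL hg hs0 hs1
  -- (≤): test `K`'s Abel floor in `K^{(p)}`'s least-constant theorem
  have hle : AL ≤ AK / (1 - s * p) := by
    refine abelSum_le_of_forall_sq_inner_le hw0 hAi hAc hAL hlinL hsymmL hcontrL hg hs0 hs1
      (div_nonneg hAK0 hsp1.le) fun v hv => ?_
    have h := sq_inner_le_abelSum_mul_quadForm hw0 hAi hAc hAK hlin hsymm hcontr hg hv hr0 hr1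
    rw [quadForm_lazy_eq hAi hAK hL hsp hv]
    calc (∫ x, g x * v x * w x ∂μ) ^ 2
        ≤ AK * ((∫ x, v x ^ 2 * w x ∂μ) - r * ∫ x, v x * K v x * w x ∂μ) := h
      _ = AK / (1 - s * p) * ((1 - s * p)
          * ((∫ x, v x ^ 2 * w x ∂μ) - r * ∫ x, v x * K v x * w x ∂μ)) := by
          field_simp
  -- (≥): test `K^{(p)}`'s Abel floor in `K`'s least-constant theorem
  have hge : AK ≤ (1 - s * p) * AL := by
    refine abelSum_le_of_forall_sq_inner_le hw0 hAi hAc hAK hlin hsymm hcontr hg hr0 hr1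
      (mul_nonneg hsp1.le hAL0) fun v hv => ?_
    have h := sq_inner_le_abelSum_mul_quadForm hw0 hAi hAc hAL hlinL hsymmL hcontrL hg hv hs0 hs1
    rw [quadForm_lazy_eq hAi hAK hL hsp hv] at h
    calc (∫ x, g x * v x * w x ∂μ) ^ 2
        ≤ AL * ((1 - s * p) * ((∫ x, v x ^ 2 * w x ∂μ) - r * ∫ x, v x * K v x * w x ∂μ)) := h
      _ = (1 - s * p) * AL * ((∫ x, v x ^ 2 * w x ∂μ) - r * ∫ x, v x * K v x * w x ∂μ) := by
          ring
  refine le_antisymm hle ?_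
  rw [div_le_iff₀ hsp1]
  linarith

/-! ## §4 At `r = 1`: `τ_int^{(p)} + ½ = (τ_int + ½)/(1 − p)` -/

/-- Under the standing summability hypothesis (`P > 0`) the full autocovariance series is summable
and its sum `Σ_k C(k) = P (τ_int + ½)` is nonnegative. -/
theorem summable_and_tsum_autocov_nonneg (hw0 : ∀ x, 0 ≤ w x)
    (hAi : ∀ ⦃f h : X → ℝ⦄, A f → A h → Integrable (fun x => f x * h x * w x) μ)
    (hAK : ∀ ⦃f : X → ℝ⦄, A f → A (K f))
    (hsymm : ∀ ⦃f h : X → ℝ⦄, A f → A h →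
      ∫ x, K f x * h x * w x ∂μ = ∫ x, f x * K h x * w x ∂μ)
    (hcontr : ∀ ⦃f : X → ℝ⦄, A f → ∫ x, K f x ^ 2 * w x ∂μ ≤ ∫ x, f x ^ 2 * w x ∂μ)
    {g : X → ℝ} (hg : A g) (hP : 0 < ∫ x, g x ^ 2 * w x ∂μ)
    (hs : Summable fun n => (∫ x, g x * (K^[n + 1] g) x * w x ∂μ) / ∫ x, g x ^ 2 * w x ∂μ) :
    (Summable fun k => ∫ x, g x * (K^[k] g) x * w x ∂μ) ∧
    0 ≤ ∑' k, ∫ x, g x * (K^[k] g) x * w x ∂μ := by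
  have hsρ : Summable fun k => (∫ x, g x * (K^[k] g) x * w x ∂μ) / ∫ x, g x ^ 2 * w x ∂μ :=
    (summable_nat_add_iff 1).1 hs
  have hsC : Summable fun k => ∫ x, g x * (K^[k] g) x * w x ∂μ :=
    (hsρ.mul_left (∫ x, g x ^ 2 * w x ∂μ)).congr fun k => mul_div_cancel₀ _ hP.ne'
  refine ⟨hsC, ?_⟩
  have hC0 : (∫ x, g x * (K^[0] g) x * w x ∂μ) = ∫ x, g x ^ 2 * w x ∂μ := by
    simp only [Function.iterate_zero, id_eq]
    exact integral_congr_ae (Eventually.of_forall fun x => by ring)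
  have h1 : ∑' k, (∫ x, g x * (K^[k] g) x * w x ∂μ) / ∫ x, g x ^ 2 * w x ∂μ
      = tauInt (fun n => (∫ x, g x * (K^[n] g) x * w x ∂μ) / ∫ x, g x ^ 2 * w x ∂μ) + 1 / 2 := by
    rw [hsρ.tsum_eq_zero_add, hC0, div_self hP.ne']
    simp only [tauInt]
    ring
  have h2 := tauInt_ge_neg_half hw0 hAi hAK hsymm hcontr hg hs
  have h3 : 0 ≤ (∑' k, ∫ x, g x * (K^[k] g) x * w x ∂μ) / ∫ x, g x ^ 2 * w x ∂μ := by
    rw [← tsum_div_const, h1]; linarith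
  exact (div_nonneg_iff.1 h3).elim (fun h => h.1) fun h => absurd h.2 (not_le.2 hP)

/-- **`Σ_k C^{(p)}(k) = (Σ_k C(k))/(1 − p)`** when both autocovariance series are summable
(`0 ≤ p < 1`, `P > 0`). -/
theorem tsum_lazy_eq (hw0 : ∀ x, 0 ≤ w x)
    (hAi : ∀ ⦃f h : X → ℝ⦄, A f → A h → Integrable (fun x => f x * h x * w x) μ)
    (hAc : ∀ ⦃f h : X → ℝ⦄ (c : ℝ), A f → A h → A (fun x => f x + c * h x))
    (hAK : ∀ ⦃f : X → ℝ⦄, A f → A (K f))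
    (hlin : ∀ ⦃f h : X → ℝ⦄ (c : ℝ), A f → A h →
      ∀ x, K (fun s => f s + c * h s) x = K f x + c * K h x)
    (hsymm : ∀ ⦃f h : X → ℝ⦄, A f → A h →
      ∫ x, K f x * h x * w x ∂μ = ∫ x, f x * K h x * w x ∂μ)
    (hcontr : ∀ ⦃f : X → ℝ⦄, A f → ∫ x, K f x ^ 2 * w x ∂μ ≤ ∫ x, f x ^ 2 * w x ∂μ)
    (hL : ∀ f x, L f x = (1 - p) * K f x + p * f x)
    (hp0 : 0 ≤ p) (hp1 : p < 1) {g : X → ℝ} (hg : A g) (hP : 0 < ∫ x, g x ^ 2 * w x ∂μ)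
    (hs : Summable fun n => (∫ x, g x * (K^[n + 1] g) x * w x ∂μ) / ∫ x, g x ^ 2 * w x ∂μ)
    (hsL : Summable fun n => (∫ x, g x * (L^[n + 1] g) x * w x ∂μ) / ∫ x, g x ^ 2 * w x ∂μ) :
    ∑' k, ∫ x, g x * (L^[k] g) x * w x ∂μ = (∑' k, ∫ x, g x * (K^[k] g) x * w x ∂μ) / (1 - p) := by
  have hAL : ∀ ⦃f : X → ℝ⦄, A f → A (L f) := fun f hf => lazy_mem hAc hAK hL hf
  have hlinL : ∀ ⦃f h : X → ℝ⦄ (c : ℝ), A f → A h → ∀ x,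
      L (fun s => f s + c * h s) x = L f x + c * L h x :=
    fun f h c hf hh x => lazy_add_mul hlin hL c hf hh x
  have hsymmL : ∀ ⦃f h : X → ℝ⦄, A f → A h →
      ∫ x, L f x * h x * w x ∂μ = ∫ x, f x * L h x * w x ∂μ :=
    fun f h hf hh => lazy_symm hAi hAK hsymm hL hf hh
  have hcontrL : ∀ ⦃f : X → ℝ⦄, A f → ∫ x, L f x ^ 2 * w x ∂μ ≤ ∫ x, f x ^ 2 * w x ∂μ :=
    fun f hf => lazy_contr hw0 hAi hAc hAK hcontr hL hp0 hp1.le hf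
  have hp : p ≠ 1 := hp1.ne
  have h1p : 0 < 1 - p := by linarith
  obtain ⟨hsC, hTC⟩ := summable_and_tsum_autocov_nonneg hw0 hAi hAK hsymm hcontr hg hP hs
  obtain ⟨hsCL, hTL⟩ := summable_and_tsum_autocov_nonneg hw0 hAi hAL hsymmL hcontrL hg hP hsL
  have hdivC : (∑' k, (∫ x, g x * (K^[k] g) x * w x ∂μ) / ∫ x, g x ^ 2 * w x ∂μ)
      = (∑' k, ∫ x, g x * (K^[k] g) x * w x ∂μ) / ∫ x, g x ^ 2 * w x ∂μ := tsum_div_const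
  have hdivL : (∑' k, (∫ x, g x * (L^[k] g) x * w x ∂μ) / ∫ x, g x ^ 2 * w x ∂μ)
      = (∑' k, ∫ x, g x * (L^[k] g) x * w x ∂μ) / ∫ x, g x ^ 2 * w x ∂μ := tsum_div_const
  -- (≤)
  have hle : ∑' k, ∫ x, g x * (L^[k] g) x * w x ∂μ
      ≤ (∑' k, ∫ x, g x * (K^[k] g) x * w x ∂μ) / (1 - p) := by
    refine tsum_le_of_forall_sq_inner_le_dirichlet hAi hAc hAL hlinL hsymmL hg hsCL
      (div_nonneg hTC h1p.le) fun v hv => ?_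
    have h := sq_inner_le_tsum_mul_dirichlet hw0 hAi hAc hAK hlin hsymm hcontr hg hv hs
    rw [hdivC, ← mul_assoc, mul_div_cancel₀ _ hP.ne'] at h
    rw [dirichlet_lazy_eq hAi hAK hL hp hv]
    calc (∫ x, g x * v x * w x ∂μ) ^ 2
        ≤ (∑' k, ∫ x, g x * (K^[k] g) x * w x ∂μ)
          * ((∫ x, v x ^ 2 * w x ∂μ) - ∫ x, v x * K v x * w x ∂μ) := h
      _ = (∑' k, ∫ x, g x * (K^[k] g) x * w x ∂μ) / (1 - p) * ((1 - p)
          * ((∫ x, v x ^ 2 * w x ∂μ) - ∫ x, v x * K v x * w x ∂μ)) := by field_simp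
  -- (≥)
  have hge : ∑' k, ∫ x, g x * (K^[k] g) x * w x ∂μ
      ≤ (1 - p) * ∑' k, ∫ x, g x * (L^[k] g) x * w x ∂μ := by
    refine tsum_le_of_forall_sq_inner_le_dirichlet hAi hAc hAK hlin hsymm hg hsC
      (mul_nonneg h1p.le hTL) fun v hv => ?_
    have h := sq_inner_le_tsum_mul_dirichlet hw0 hAi hAc hAL hlinL hsymmL hcontrL hg hv hsL
    rw [hdivL, ← mul_assoc, mul_div_cancel₀ _ hP.ne', dirichlet_lazy_eq hAi hAK hL hp hv] at h
    calc (∫ x, g x * v x * w x ∂μ) ^ 2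
        ≤ (∑' k, ∫ x, g x * (L^[k] g) x * w x ∂μ)
          * ((1 - p) * ((∫ x, v x ^ 2 * w x ∂μ) - ∫ x, v x * K v x * w x ∂μ)) := h
      _ = (1 - p) * (∑' k, ∫ x, g x * (L^[k] g) x * w x ∂μ)
          * ((∫ x, v x ^ 2 * w x ∂μ) - ∫ x, v x * K v x * w x ∂μ) := by ring
  refine le_antisymm hle ?_
  rw [div_le_iff₀ h1p]
  linarith

/-- **THE LAZY-CHAIN LAW FOR `τ_int`.**  `g ∈ A` with `C_g(0) > 0`; if the normalised autocorrelation
series of `g` under `K` and under `K^{(p)} = (1 − p)K + p·1` are both summable (`0 ≤ p < 1`), then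
`τ_int^{(p)}(g) + ½ = (τ_int(g) + ½)/(1 − p)`. -/
theorem tauInt_lazy_eq (hw0 : ∀ x, 0 ≤ w x)
    (hAi : ∀ ⦃f h : X → ℝ⦄, A f → A h → Integrable (fun x => f x * h x * w x) μ)
    (hAc : ∀ ⦃f h : X → ℝ⦄ (c : ℝ), A f → A h → A (fun x => f x + c * h x))
    (hAK : ∀ ⦃f : X → ℝ⦄, A f → A (K f))
    (hlin : ∀ ⦃f h : X → ℝ⦄ (c : ℝ), A f → A h →
      ∀ x, K (fun s => f s + c * h s) x = K f x + c * K h x)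
    (hsymm : ∀ ⦃f h : X → ℝ⦄, A f → A h →
      ∫ x, K f x * h x * w x ∂μ = ∫ x, f x * K h x * w x ∂μ)
    (hcontr : ∀ ⦃f : X → ℝ⦄, A f → ∫ x, K f x ^ 2 * w x ∂μ ≤ ∫ x, f x ^ 2 * w x ∂μ)
    (hL : ∀ f x, L f x = (1 - p) * K f x + p * f x)
    (hp0 : 0 ≤ p) (hp1 : p < 1) {g : X → ℝ} (hg : A g) (hP : 0 < ∫ x, g x ^ 2 * w x ∂μ)
    (hs : Summable fun n => (∫ x, g x * (K^[n + 1] g) x * w x ∂μ) / ∫ x, g x ^ 2 * w x ∂μ)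
    (hsL : Summable fun n => (∫ x, g x * (L^[n + 1] g) x * w x ∂μ) / ∫ x, g x ^ 2 * w x ∂μ) :
    tauInt (fun n => (∫ x, g x * (L^[n] g) x * w x ∂μ) / ∫ x, g x ^ 2 * w x ∂μ) + 1 / 2
      = (tauInt (fun n => (∫ x, g x * (K^[n] g) x * w x ∂μ) / ∫ x, g x ^ 2 * w x ∂μ) + 1 / 2)
        / (1 - p) := by
  have hmain := tsum_lazy_eq hw0 hAi hAc hAK hlin hsymm hcontr hL hp0 hp1 hg hP hs hsL
  have hsρ : Summable fun k => (∫ x, g x * (K^[k] g) x * w x ∂μ) / ∫ x, g x ^ 2 * w x ∂μ :=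
    (summable_nat_add_iff 1).1 hs
  have hsρL : Summable fun k => (∫ x, g x * (L^[k] g) x * w x ∂μ) / ∫ x, g x ^ 2 * w x ∂μ :=
    (summable_nat_add_iff 1).1 hsL
  have hC0 : (∫ x, g x * (K^[0] g) x * w x ∂μ) = ∫ x, g x ^ 2 * w x ∂μ := by
    simp only [Function.iterate_zero, id_eq]
    exact integral_congr_ae (Eventually.of_forall fun x => by ring)
  have hCL0 : (∫ x, g x * (L^[0] g) x * w x ∂μ) = ∫ x, g x ^ 2 * w x ∂μ := by
    simp only [Function.iterate_zero, id_eq]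
    exact integral_congr_ae (Eventually.of_forall fun x => by ring)
  have h1 : (∑' k, ∫ x, g x * (K^[k] g) x * w x ∂μ) / ∫ x, g x ^ 2 * w x ∂μ
      = tauInt (fun n => (∫ x, g x * (K^[n] g) x * w x ∂μ) / ∫ x, g x ^ 2 * w x ∂μ) + 1 / 2 := by
    rw [← tsum_div_const, hsρ.tsum_eq_zero_add, hC0, div_self hP.ne']
    simp only [tauInt]
    ring
  have h1L : (∑' k, ∫ x, g x * (L^[k] g) x * w x ∂μ) / ∫ x, g x ^ 2 * w x ∂μ
      = tauInt (fun n => (∫ x, g x * (L^[n] g) x * w x ∂μ) / ∫ x, g x ^ 2 * w x ∂μ) + 1 / 2 := by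
    rw [← tsum_div_const, hsρL.tsum_eq_zero_add, hCL0, div_self hP.ne']
    simp only [tauInt]
    ring
  rw [← h1, ← h1L, hmain, div_div, div_div, mul_comm]

end RevOp

end Summit.Ventures.LatticeQCDFlow.Exactness
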